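import Literature.AlgebraicGeometry.ComplexMultiplication.CMTorusProductsMumfordTateRankBounds
import Literature.NumberTheory.ComplexMultiplication.CMAlgebraTorusTypeOfIsogenyClass
import Literature.Geometry.Kaehler.ComplexTorusIdempotentRelations
import HarnessLib

/-!
# The Mumford–Tate dimension of a torus with multiplication by a CM-algebra: `dim MT(H¹(X, ℚ)) = rank (Φᵢ)ᵢ`, and
# `X` is (stably) nondegenerate iff `dim MT = dim X + 1`
# (Deligne 1982 I Example 3.7 (c); Gordon 1999 7.5–7.6, 9.1; Shimura 1998 §18.7 — for the abstract class `IsCMAlgTorusRat`)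

Topic `Literature/AlgebraicGeometry/ComplexMultiplication`, namespace `Literature.NumberTheory.ComplexMultiplication.IsCMAlgTorusRat`;
lane `lit-hodgefound` (Track 2 foundations library), Layers A3/A4 (rows A3.5.2–A3.5.4 «MT of a CM AV is a torus of dimension
`Rank(Φ)`»), seat p19 generation 25, row g25-#9 — the companion of g25-#8 (`CMAlgebraTorusHodgeClassesPohlmann.lean`: Pohlmann's
count for `IsCMAlgTorusRat`).  JUNCTION of p19's series (`IsCMAlgTorusRat P ρ`, its CM types `h.cmType i`, and
`isIsogenous_sigmaPi_periodEquiv`: `X ∼ ∏ᵢ ℂ^{Φᵢ}/u(𝔪ᵢ)`) with the product file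
`CMTorusProductsMumfordTateRank.lean` (`CMTorus.mtRank_hodgeStructure_eq_cmFamilyRank_of_isIsogenous`,
`isNondegenerateFamily_iff_mtRank_hodgeStructure_sigmaPiPeriod_eq`, `mtRank_hodgeStructure_sigmaPiPeriod_le`, over ANY finite index
type) and the isogeny invariance of `dim MT` (`Geometry/Kaehler/ComplexTorusMumfordTateRankIsogeny`).  As there, the tensor
constructions behind `HodgeStructure.mtRank` are taken under the tree's instance hypothesis `[HodgeTensorFacts.{0,0}]`
(discharged by `Motives.hodgeTensorFacts_holds`) and the finite-dimensionality of `H¹(X, ℚ)` as an instance ARGUMENT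
(`finiteDimensional_rationalForms P 1`).  THEOREMS ONLY: no definition, no named fact (net debt 0).

## Sources, VERBATIM

* P. Deligne, *Hodge cycles on abelian varieties*, LNM 900 (1982) [Deligne1982HodgeCycles], I Example 3.7 (pp. 25–26, (c)):
  for `A = ∏ A_i` of CM type by the CM algebra `E`, `MT(A)` is the image of the reflex-norm torus; its dimension is the
  rank of the span of the Galois translates of `Σ`.
* B. B. Gordon, *A survey of the Hodge conjecture for abelian varieties* (1999) [Gordon1999HodgeAVSurvey], 2.1.7 (`MT` of an
  isogeny class), 7.5–7.6 («`rank Hg(A)_ℂ = rdim A`» ⟺ nondegenerate), 9.1 (`rank := dim MT(A)` for CM `A`).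
* G. Shimura, *Abelian Varieties with Complex Multiplication and Modular Functions* (1998) [Shimura1998], §18.7 (p. 129):
  «`A` is isogenous to `A_1 × ⋯ × A_t` … `(A_i, ι_i)` determines a CM-type `(K_i, Φ_i)`».

## What this file proves (all sorry-free; `h : IsCMAlgTorusRat P ρ`, `L : t → Type` number fields)

* **`mtRank_hodgeStructure_eq_cmFamilyRank`** — `dim MT(H¹(X, ℚ)) = CMAlgebra.cmFamilyRank h.cmType` (the rank of the family
  `(Φᵢ)ᵢ`, Deligne's Example 3.7 (c) on the isogeny class);
* `sum_finrank_div_two_eq_finrank` — `(Σᵢ [Lᵢ : ℚ]) / 2 = dim_ℂ X`;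
* **`isNondegenerateFamily_iff_mtRank_eq`** — `(Φᵢ)ᵢ` is nondegenerate iff `dim MT(H¹(X, ℚ)) = dim X + 1` (Gordon 7.5);
* `mtRank_hodgeStructure_le` — `dim MT(H¹(X, ℚ)) ≤ dim X + 1` (CM fields `Lᵢ`);
* `mtRank_hodgeStructure_eq_of_cmType_eq` — tori with multiplication by `Y` of the same type have the same `dim MT`;
* the factors: `mtRank_hodgeStructure_idemPeriod_eq_cmTypeRank` (`dim MT(H¹(X^{εⱼ})) = Rank(Φⱼ)`),
  **`cmTypeRank_le_mtRank_hodgeStructure`** / `mtRank_hodgeStructure_idemPeriod_le` (`Rank(Φⱼ) ≤ dim MT(H¹(X))`, the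
  projections `Hg(X) → Hg(X^{εⱼ})` are onto), **`mtRank_hodgeStructure_add_card_le`** (`dim MT(H¹(X)) + t ≤ Σᵢ Rank(Φᵢ) + 1`,
  «`Hg(X) ⊆ ∏ Hg(X_i)`») — the combinatorial bounds of `CMTorusProductsMumfordTateRankBounds` read on `X`.

## References

* [Deligne1982HodgeCycles] P. Deligne, in LNM 900 (1982), I §3 Prop. 3.4, Example 3.7.
* [Gordon1999HodgeAVSurvey] B. B. Gordon, Appendix B to J. D. Lewis, *A survey of the Hodge conjecture* (1999), 2.1.7,
  7.5–7.6, 9.1.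
* [Shimura1998] G. Shimura, *Abelian Varieties with Complex Multiplication and Modular Functions*, Princeton (1998), §18.7.
* [MoonenZarhin1999LowDim] B. Moonen, Yu. Zarhin, *Hodge classes on abelian varieties of low dimension*, Math. Ann. 315
  (1999), §3 (3.1).
-/

noncomputable section

open scoped Classical
open Module NumberField

namespace Literature.NumberTheory.ComplexMultiplication

open Literature.AlgebraicGeometry.Motives (CMType)
open Literature.AlgebraicGeometry.Pohlmann1968
open Literature.AlgebraicGeometry.ComplexMultiplication (CMTorus.periodEquiv)
open Literature.Geometry.Kaehler
open Literature.Geometry.Kaehler.ComplexTorus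

namespace IsCMAlgTorusRat

variable {t : Type} {L : t → Type} [∀ i, Field (L i)] [∀ i, NumberField (L i)] [Fintype t] [DecidableEq t]
variable {ι : Type} [Fintype ι] [DecidableEq ι] {E : Type} [NormedAddCommGroup E] [NormedSpace ℂ E]
  {P : (ι → ℝ) ≃L[ℝ] E} {ρ : (Π i, L i) →ₐ[ℚ] Matrix ι ι ℚ}

omit [DecidableEq t] in
/-- `(Σᵢ [Lᵢ : ℚ]) / 2 = dim_ℂ X` («`2 dim(A) = [Y : ℚ]`»). [cite: Shimura1998, §18.7, p. 129] -/
theorem sum_finrank_div_two_eq_finrank (h : IsCMAlgTorusRat P ρ) : (∑ i, finrank ℚ (L i)) / 2 = finrank ℂ E := by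
  rw [← finrank_pi_eq_sum, h.finrank_eq]
  omega

variable [Literature.AlgebraicGeometry.Motives.HodgeTensorFacts.{0, 0}]

/-- **`dim MT(H¹(X, ℚ)) = rank (Φᵢ)ᵢ` FOR EVERY TORUS WITH MULTIPLICATION BY A CM-ALGEBRA** (`CMAlgebra.cmFamilyRank`: the rank
of the span of the `Aut(ℂ)`-translates of `Σ = ⊔ᵢ Φᵢ`; Deligne's Example 3.7 (c) read on the isogeny class of `∏ᵢ ℂ^{Φᵢ}/u(𝔪ᵢ)`,
of which `X` is a member, Shimura §18.7). [cite: Deligne1982HodgeCycles, I Example 3.7 (c) and Prop. 3.4] [cite: Gordon1999HodgeAVSurvey, 2.1.7 and 9.1] [cite: Shimura1998, §18.7, p. 129] -/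
theorem mtRank_hodgeStructure_eq_cmFamilyRank (h : IsCMAlgTorusRat P ρ) [Module.Finite ℚ (rationalForms P 1)] :
    (hodgeStructure P 1).mtRank = CMAlgebra.cmFamilyRank h.cmType := by
  haveI : Module.Finite ℚ (rationalForms
      (sigmaPiPeriod fun i => CMTorus.periodEquiv (h.cmType i) (Module.finBasis ℚ (L i))) 1) :=
    finiteDimensional_rationalForms _ 1
  exact Literature.AlgebraicGeometry.ComplexMultiplication.CMTorus.mtRank_hodgeStructure_eq_cmFamilyRank_of_isIsogenous
    h.cmType (fun i => Module.finBasis ℚ (L i)) (h.isIsogenous_sigmaPi_periodEquiv fun i => Module.finBasis ℚ (L i))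

/-- **GORDON 7.5 FOR A TORUS WITH MULTIPLICATION BY A CM-ALGEBRA: `(Φᵢ)ᵢ` is nondegenerate iff `dim MT(H¹(X, ℚ)) = dim X + 1`**
(«`rank Hg(A)_ℂ = rdim A`»). [cite: Gordon1999HodgeAVSurvey, 7.5–7.6] [cite: Deligne1982HodgeCycles, I Example 3.7 (c)] -/
theorem isNondegenerateFamily_iff_mtRank_eq (h : IsCMAlgTorusRat P ρ) [Module.Finite ℚ (rationalForms P 1)] :
    CMAlgebra.IsNondegenerateFamily h.cmType ↔ (hodgeStructure P 1).mtRank = finrank ℂ E + 1 := by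
  rw [CMAlgebra.isNondegenerateFamily_iff, ← h.mtRank_hodgeStructure_eq_cmFamilyRank, h.sum_finrank_div_two_eq_finrank]

/-- **`dim MT(H¹(X, ℚ)) ≤ dim X + 1`** for a torus with multiplication by a CM-algebra with CM factors `Lᵢ`
(`MT ⊆` the torus of `Y^×`-elements with `x x̄ ∈ ℚ^×`). [cite: Deligne1982HodgeCycles, I Example 3.7 (c)] [cite: Gordon1999HodgeAVSurvey, 7.5] -/
theorem mtRank_hodgeStructure_le [∀ i, IsCMField (L i)] [Nonempty t] (h : IsCMAlgTorusRat P ρ)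
    [Module.Finite ℚ (rationalForms P 1)] : (hodgeStructure P 1).mtRank ≤ finrank ℂ E + 1 := by
  rw [h.mtRank_hodgeStructure_eq_cmFamilyRank, ← h.sum_finrank_div_two_eq_finrank]
  haveI : Module.Finite ℚ (rationalForms
      (sigmaPiPeriod fun i => CMTorus.periodEquiv (h.cmType i) (Module.finBasis ℚ (L i))) 1) :=
    finiteDimensional_rationalForms _ 1
  rw [← Literature.AlgebraicGeometry.ComplexMultiplication.CMTorus.mtRank_hodgeStructure_sigmaPiPeriod_eq_cmFamilyRank
    h.cmType (fun i => Module.finBasis ℚ (L i))]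
  exact Literature.AlgebraicGeometry.ComplexMultiplication.CMTorus.mtRank_hodgeStructure_sigmaPiPeriod_le
    h.cmType (fun i => Module.finBasis ℚ (L i))

/-- **Tori with multiplication by `Y` of the same type have Mumford–Tate groups of the same dimension** (one isogeny class,
g21-#7). [cite: Gordon1999HodgeAVSurvey, 2.1.7] [cite: Shimura1998, §6.1 Cor. of Thm. 2, p. 41; §18.7, p. 129] -/
theorem mtRank_hodgeStructure_eq_of_cmType_eq (h : IsCMAlgTorusRat P ρ) [Module.Finite ℚ (rationalForms P 1)]
    {ι' : Type} [Fintype ι'] [DecidableEq ι'] {E' : Type} [NormedAddCommGroup E'] [NormedSpace ℂ E']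
    {P' : (ι' → ℝ) ≃L[ℝ] E'} [Module.Finite ℚ (rationalForms P' 1)] {ρ' : (Π i, L i) →ₐ[ℚ] Matrix ι' ι' ℚ}
    (h' : IsCMAlgTorusRat P' ρ') (hΦ : ∀ i, h.cmType i = h'.cmType i) :
    (hodgeStructure P 1).mtRank = (hodgeStructure P' 1).mtRank := by
  rw [h.mtRank_hodgeStructure_eq_cmFamilyRank, h'.mtRank_hodgeStructure_eq_cmFamilyRank]
  exact congrArg _ (funext hΦ)

/-! ### The factors: `Rank(Φⱼ) ≤ dim MT(H¹(X)) ≤ Σᵢ Rank(Φᵢ) + 1 − t` -/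

/-- **`dim MT(H¹(X^{εⱼ}, ℚ)) = Rank(Φⱼ)`** for each factor `X^{εⱼ}` (a torus of type `(Lⱼ, Φⱼ)`, the one-field junction
`IsCMTorusRat.mtRank_hodgeStructure_eq_cmTypeRank`). [cite: Gordon1999HodgeAVSurvey, 9.1] [cite: Shimura1998, §18.7 («`(A_i, ι_i)` determines a CM-type `(K_i, Φ_i)`»), p. 129] -/
theorem mtRank_hodgeStructure_idemPeriod_eq_cmTypeRank [∀ i, IsCMField (L i)] (h : IsCMAlgTorusRat P ρ) (j : t)
    [Module.Finite ℚ (rationalForms (idemPeriod P (h.idem j)) 1)] :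
    (hodgeStructure (idemPeriod P (h.idem j)) 1).mtRank = cmTypeRank (h.cmType j) :=
  (h.isCMTorusRat_restrict j).mtRank_hodgeStructure_eq_cmTypeRank

/-- **`Rank(Φⱼ) ≤ dim MT(H¹(X, ℚ))`**: the Mumford–Tate group of `X` projects ONTO that of each factor `X^{εⱼ}`
(«the projections `pr_i : Hg(X) → Hg(X_i)` are surjective»). [cite: MoonenZarhin1999LowDim, §3 (3.1)] [cite: Gordon1999HodgeAVSurvey, 7.6.1] [cite: Deligne1982HodgeCycles, I Example 3.7 (c)] -/
theorem cmTypeRank_le_mtRank_hodgeStructure (h : IsCMAlgTorusRat P ρ) [Module.Finite ℚ (rationalForms P 1)] (j : t) :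
    cmTypeRank (h.cmType j) ≤ (hodgeStructure P 1).mtRank := by
  rw [h.mtRank_hodgeStructure_eq_cmFamilyRank]
  exact CMAlgebra.cmTypeRank_le_cmFamilyRank h.cmType j

/-- **`dim MT(H¹(X^{εⱼ}, ℚ)) ≤ dim MT(H¹(X, ℚ))`** for every factor. [cite: MoonenZarhin1999LowDim, §3 (3.1)] [cite: Gordon1999HodgeAVSurvey, 7.6.1] -/
theorem mtRank_hodgeStructure_idemPeriod_le [∀ i, IsCMField (L i)] (h : IsCMAlgTorusRat P ρ)
    [Module.Finite ℚ (rationalForms P 1)] (j : t) [Module.Finite ℚ (rationalForms (idemPeriod P (h.idem j)) 1)] :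
    (hodgeStructure (idemPeriod P (h.idem j)) 1).mtRank ≤ (hodgeStructure P 1).mtRank := by
  rw [h.mtRank_hodgeStructure_idemPeriod_eq_cmTypeRank j]
  exact h.cmTypeRank_le_mtRank_hodgeStructure j

/-- **`dim MT(H¹(X, ℚ)) + t ≤ Σᵢ Rank(Φᵢ) + 1`** («`Hg(X) ⊆ Hg(X_1) × ⋯ × Hg(X_t)`» inside `∏ᵢ {x ∈ Lᵢ^× : x x̄ = 1}`, the
scalars counted once). [cite: MoonenZarhin1999LowDim, §3 (3.1)] [cite: Gordon1999HodgeAVSurvey, §3 Theorem (proof) and 7.7] -/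
theorem mtRank_hodgeStructure_add_card_le [∀ i, IsCMField (L i)] [Nonempty t] (h : IsCMAlgTorusRat P ρ)
    [Module.Finite ℚ (rationalForms P 1)] :
    (hodgeStructure P 1).mtRank + Fintype.card t ≤ (∑ i, cmTypeRank (h.cmType i)) + 1 := by
  rw [h.mtRank_hodgeStructure_eq_cmFamilyRank]
  exact CMAlgebra.cmFamilyRank_add_card_le_sum h.cmType

end IsCMAlgTorusRat

end Literature.NumberTheory.ComplexMultiplication
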